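import Summits.QuantumFields.BalabanUV.Beta.D1BFx.ChargeFreeEnvelopes
import Summits.QuantumFields.BalabanUV.Beta.D1BFx.PackedKernelSplit

/-!
# `BalabanUV.Beta.D1BFx.ChargeFreeBubble` — road «BF-x» for binder row D1, slot (K), PART 24 (R-BB supplier side): **THE TWO-LEG BUBBLE OF A CHARGE-SPLIT VERTEX
# PAIR, TWO GAINS, IN WEIGHTED-MASS CURRENCY** — `|biBubble A (Vc + Vr) B (Wc + Wr)| ≤ e^{−min(σ,2θ)|p − p′|₁}·(2β′β′-, β″β- and ββ″-terms)·(products of the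
# σ-weighted masses of the four pieces)`, with NO lattice-count ∕ `Zl` factor: the masses carry the volume and the triangle inequality carries the coarse decay

HONEST DEPENDENCY (cell records, verbatim): «continuum YM on T⁴ ⇐ BetaPertH ∧ nine spine estimates (0/9 proved); BetaPertH ⇐ (D1) ∧ (D4) ∧
CAP+tail; G-an2-4 gates asym, D1 and NE2/3/4.»  HONEST FRAMING (cell contract, verbatim): «discharging `BetaPertH` makes Bałaban's UV stability
UNCONDITIONAL — a real constructive-QFT result; it is NOT the continuum limit and NOT the Clay problem.»  THIS MODULE is [folklore] `ℓ¹`∕`tsum` bookkeeping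
over an2's `ExpKernelCalculus` (`MKer`, `comp`, `tr`, `Decays`), an5's `TameKernelCalculus` (`comp_assoc_tame`, `tr_comp_comm_loc`, `comp_add_*_tame`, `tr_add_loc`),
leaf-03's `PackedKernelSplit.biBubble` and this lineage's `ChargeFreeEnvelopes` (INTENT-1 [D1LEAF01-G30-INTENT-1]); every kernel is ARBITRARY, every envelope ∕ band ∕
charge ∕ mass a DISPLAYED `∀`-hypothesis; no `def`, no `def … : Prop`, nothing cited, 0 sorry.  WHAT IT IS FOR (OWNER d1-p2 g23 `PART24-SPEC-g23.md` §1 member (BB),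
§2 «R-BB (L, road + leaf-01)»; this seat's W-1 l.50333): the ALL-SMOOTH rest bubble — both legs carry sup `β`, unit-difference `β′` (either variable) and MIXED unit
second-difference `β″` envelopes at a common decay rate `θ` (for the road's `B = −½(sandP)_tt`: `K∕(2n²)`, `K′∕n³` = L-B′, `K″∕n⁴` = L-B″), the two vertices are
given SPLIT into a column-charge-free and a row-charge-free banded piece each (the dipole split of a zero-total-charge table), and the bound is n-free as soon as
`β′β′`, `ββ″` beat the two masses (U1: `n⁻⁶ × (n³)²`).  WHAT IT IS NOT: NOT the (A,B) ∕ (B,A) members (a Coulomb leg's mixed profile `nrm⁻⁴` is critical — those go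
through leaf-04's `ProfileWordCount` count with the charge pieces Abel-summed onto the packing columns, NOT here); NOT the split of the road's packed vertex (the
OWNER's instance); NOT L-B″; NOT a (1.22) row; 0 root-level binders of row D1 discharged (hW ∕ hR-sockets ∕ hSX-socket ∕ D1Tel ∕ D1Rep = 0); (K) NOT closed; NOT D1,
NOT `BetaPertH`, NOT continuum, NOT Clay.
ABSOLUTE RULE (cell charter, verbatim): «No internally-minted statement may enter as a cited fact. Every hypothesis is either kernel-proved in
this package or a verbatim quotation of a PUBLISHED theorem with page reference. The manuscript(s) under audit are NOT citable for their own
disputed steps — they are the thing under adjudication; programme-internal (2001/route/tribunal) claims are never citable.»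

CONTENT ([folklore]; `D`, `F` arbitrary).
* §1 **`abs_tr_comp_le_weighted`** — THE WEIGHTED-MASS TRACE LEMMA: `|P x y a f| ≤ e^{−θ|x−y|₁}·u(x,a)·v(y,f)`, `|Q y x f a| ≤ e^{−θ|y−x|₁}·u′(y,f)·v′(x,a)` (all weights
  `≥ 0`, `θ, σ ≥ 0`) ⟹ `|tr (P ∘ Q)| ≤ e^{−min(σ,2θ)|pX − pY|₁}·(Σ'_x (Σ_a u v′)·e^{σ|x − pX|₁})·(Σ'_y (Σ_f v u′)·e^{σ|y − pY|₁})` — the triangle inequality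
  `|pX − pY|₁ ≤ |pX − x|₁ + |x − y|₁ + |y − pY|₁` trades the legs' decay for the coarse decay; no volume sum is ever taken.
* §2 **`biBubble_chargeSplit_eq`** — THE FOUR-TERM ALGEBRA (spread legs, localised pieces): `biBubble A (Vc+Vr) B (Wc+Wr) = tr((A∘Vc)∘(B∘Wc)) + tr(((Wr∘A)∘Vc)∘B) +
  tr(A∘((Vr∘B)∘Wc)) + tr((Vr∘B)∘(Wr∘A))` — each term grouped so that every charge-free piece sits on the side of the leg it gains on (associativity + cyclicity of
  the tame trace calculus).
* §3 **`abs_biBubble_le_of_chargeSplit`** — THE BOUND: legs `Decays A βA θ`, `Decays B βB θ` (`θ > 0`) with unit-difference letters `β′A, β′B` in BOTH variables and mixed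
  letters `β″A, β″B`; pieces `Loc`, banded (`R`), column- resp. row-charge-free; σ-weighted column masses of `Vc` (centre `p`) and `Wc` (centre `p′`) `≤ MVc, MWc`, row
  masses of `Vr`, `Wr` `≤ MVr, MWr` ⟹ `|biBubble A (Vc + Vr) B (Wc + Wr)| ≤ e^{−min(σ,2θ)|p − p′|₁}·((β′A·R·e^{θR})(β′B·R·e^{θR})(MVc·MWc + MVr·MWr) +
  (β″A·R²·e^{2θR})·βB·MVc·MWr + βA·(β″B·R²·e^{2θR})·MVr·MWc)`.
Unit `b2b-balaban-beta-d1-formalise-leaf-01` (gen 30), D1 swarm LEAF PROVER 01, road «BF-x»; INTENT-2 [D1LEAF01-G30-INTENT-2].  Not in print; our bookkeeping.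
-/

noncomputable section

open scoped BigOperators

namespace Summit.QuantumFields.BalabanUV.Beta.D1BFx.ChargeFreeBubble

open Literature.MathematicalPhysics.QuantumFieldTheory.Balaban1983to89
open Literature.MathematicalPhysics.QuantumFieldTheory.Balaban1983to89.Beta
open B12Sec2to5 (l1 l1_nonneg)
open ExpKernelCalculus (Site MKer Decays comp tr l1_sub_triangle l1_sub_symm)
open AffineAveraging (unitVec)
open Summit.QuantumFields.BalabanUV.Beta.TameKernelCalculus (Tame Spr Loc comp_assoc_tame tr_comp_comm_loc comp_add_right_tame comp_add_left_tame tr_add_loc)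
open Summit.QuantumFields.BalabanUV.Beta.D1BFx.PackedKernelSplit (biBubble)
open Summit.QuantumFields.BalabanUV.Beta.D1BFx.ChargeFreeEnvelopes (abs_comp_le_of_colFree_unitDiff abs_comp_le_of_rowFree_unitDiff abs_comp_comp_le_of_unitDiffMixed)

variable {D : ℕ} {F : Type*} [Fintype F]

/-! ## §1 The weighted-mass trace lemma -/

omit [Fintype F] in
/-- [folklore] The exponent bookkeeping: `e^{−θ|x−y|₁}·e^{−θ|y−x|₁} ≤ e^{−min(σ,2θ)|pX − pY|₁}·e^{σ|x − pX|₁}·e^{σ|y − pY|₁}` (`θ, σ ≥ 0`; triangle inequality). -/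
theorem exp_pair_le_weighted {θ σ : ℝ} (hθ : 0 ≤ θ) (hσ : 0 ≤ σ) (x y pX pY : Site D) :
    Real.exp (-θ * l1 (x - y)) * Real.exp (-θ * l1 (y - x))
      ≤ Real.exp (-(min σ (2 * θ)) * l1 (pX - pY)) * Real.exp (σ * l1 (x - pX)) * Real.exp (σ * l1 (y - pY)) := by
  rw [← Real.exp_add, ← Real.exp_add, ← Real.exp_add, Real.exp_le_exp, l1_sub_symm y x]
  have t1 : l1 (pX - pY) ≤ l1 (pX - x) + l1 (x - pY) := l1_sub_triangle pX x pY
  have t2 : l1 (x - pY) ≤ l1 (x - y) + l1 (y - pY) := l1_sub_triangle x y pY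
  rw [l1_sub_symm pX x] at t1
  have hm1 : min σ (2 * θ) ≤ σ := min_le_left _ _
  have hm2 : min σ (2 * θ) ≤ 2 * θ := min_le_right _ _
  have hm0 : 0 ≤ min σ (2 * θ) := le_min hσ (by linarith)
  nlinarith [l1_nonneg (x - pX), l1_nonneg (y - pY), l1_nonneg (x - y), l1_nonneg (pX - pY),
    mul_le_mul_of_nonneg_right hm1 (l1_nonneg (x - pX)), mul_le_mul_of_nonneg_right hm1 (l1_nonneg (y - pY)),
    mul_le_mul_of_nonneg_right hm2 (l1_nonneg (x - y)), mul_nonneg hm0 (show 0 ≤ l1 (x - pX) + l1 (x - y) + l1 (y - pY) - l1 (pX - pY) by linarith)]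

/-- [folklore] **THE WEIGHTED-MASS TRACE LEMMA.**  If `|P x y a f| ≤ e^{−θ|x−y|₁}·u(x,a)·v(y,f)` and `|Q y x f a| ≤ e^{−θ|y−x|₁}·u′(y,f)·v′(x,a)` with nonnegative weights,
`θ, σ ≥ 0`, and the σ-weighted sums `Σ'_x (Σ_a u·v′)(x)·e^{σ|x−pX|₁}`, `Σ'_y (Σ_f v·u′)(y)·e^{σ|y−pY|₁}` converge, then
`|tr (P ∘ Q)| ≤ e^{−min(σ,2θ)|pX − pY|₁}·(first sum)·(second sum)`.  No volume factor: the weights carry it. -/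
theorem abs_tr_comp_le_weighted {P Q : MKer D F} {θ σ : ℝ} (hθ : 0 ≤ θ) (hσ : 0 ≤ σ)
    {u v' : Site D → F → ℝ} {v u' : Site D → F → ℝ}
    (hu : ∀ x a, 0 ≤ u x a) (hv : ∀ y f, 0 ≤ v y f) (hu' : ∀ y f, 0 ≤ u' y f) (hv' : ∀ x a, 0 ≤ v' x a)
    (hP : ∀ (x y : Site D) (a f : F), |P x y a f| ≤ Real.exp (-θ * l1 (x - y)) * u x a * v y f)
    (hQ : ∀ (y x : Site D) (f a : F), |Q y x f a| ≤ Real.exp (-θ * l1 (y - x)) * u' y f * v' x a)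
    (pX pY : Site D)
    (hX : Summable fun x : Site D => (∑ a, u x a * v' x a) * Real.exp (σ * l1 (x - pX)))
    (hY : Summable fun y : Site D => (∑ f, v y f * u' y f) * Real.exp (σ * l1 (y - pY))) :
    |tr (comp P Q)| ≤ Real.exp (-(min σ (2 * θ)) * l1 (pX - pY))
        * (∑' x : Site D, (∑ a, u x a * v' x a) * Real.exp (σ * l1 (x - pX)))
        * (∑' y : Site D, (∑ f, v y f * u' y f) * Real.exp (σ * l1 (y - pY))) := by
  classical
  set E : ℝ := Real.exp (-(min σ (2 * θ)) * l1 (pX - pY)) with hE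
  set WX : ℝ := ∑' x : Site D, (∑ a, u x a * v' x a) * Real.exp (σ * l1 (x - pX)) with hWX
  set WY : ℝ := ∑' y : Site D, (∑ f, v y f * u' y f) * Real.exp (σ * l1 (y - pY)) with hWY
  have hE0 : 0 ≤ E := (Real.exp_pos _).le
  have hUV0 : ∀ x a, 0 ≤ u x a * v' x a := fun x a => mul_nonneg (hu x a) (hv' x a)
  have hVU0 : ∀ y f, 0 ≤ v y f * u' y f := fun y f => mul_nonneg (hv y f) (hu' y f)
  have hWY0 : 0 ≤ WY := tsum_nonneg fun y => mul_nonneg (Finset.sum_nonneg fun f _ => hVU0 y f) (Real.exp_pos _).le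
  -- pointwise
  have key : ∀ (x y : Site D) (a f : F), |P x y a f * Q y x f a|
      ≤ E * ((u x a * v' x a) * Real.exp (σ * l1 (x - pX))) * ((v y f * u' y f) * Real.exp (σ * l1 (y - pY))) := by
    intro x y a f
    rw [abs_mul]
    have h1 := hP x y a f
    have h2 := hQ y x f a
    have hb : |P x y a f| * |Q y x f a| ≤ (Real.exp (-θ * l1 (x - y)) * u x a * v y f) * (Real.exp (-θ * l1 (y - x)) * u' y f * v' x a) :=
      mul_le_mul h1 h2 (abs_nonneg _) ((abs_nonneg _).trans h1)
    refine hb.trans ?_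
    have hexp := exp_pair_le_weighted hθ hσ x y pX pY
    have e1 : Real.exp (-θ * l1 (x - y)) * u x a * v y f * (Real.exp (-θ * l1 (y - x)) * u' y f * v' x a)
        = (Real.exp (-θ * l1 (x - y)) * Real.exp (-θ * l1 (y - x))) * ((u x a * v' x a) * (v y f * u' y f)) := by ring
    have e2 : E * (u x a * v' x a * Real.exp (σ * l1 (x - pX))) * (v y f * u' y f * Real.exp (σ * l1 (y - pY)))
        = (E * Real.exp (σ * l1 (x - pX)) * Real.exp (σ * l1 (y - pY))) * ((u x a * v' x a) * (v y f * u' y f)) := by ring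
    rw [e1, e2]
    exact mul_le_mul_of_nonneg_right hexp (mul_nonneg (hUV0 x a) (hVU0 y f))
  -- inner sums
  have inner : ∀ (x : Site D) (a : F), |∑' y : Site D, ∑ f, P x y a f * Q y x f a| ≤ E * ((u x a * v' x a) * Real.exp (σ * l1 (x - pX))) * WY := by
    intro x a
    set c : ℝ := E * ((u x a * v' x a) * Real.exp (σ * l1 (x - pX))) with hc
    have hc0 : 0 ≤ c := mul_nonneg hE0 (mul_nonneg (hUV0 x a) (Real.exp_pos _).le)
    have hmaj : HasSum (fun y : Site D => c * ((∑ f, v y f * u' y f) * Real.exp (σ * l1 (y - pY)))) (c * WY) := by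
      rw [hWY]; exact hY.hasSum.mul_left c
    have h := tsum_of_norm_bounded hmaj fun y => by
      rw [Real.norm_eq_abs]
      refine (Finset.abs_sum_le_sum_abs (fun f => P x y a f * Q y x f a) Finset.univ).trans ?_
      rw [Finset.sum_mul, Finset.mul_sum]
      exact Finset.sum_le_sum fun f _ => (key x y a f).trans (le_of_eq (by rw [hc]))
    rw [Real.norm_eq_abs] at h
    rw [hc] at h
    exact h
  -- outer sum
  have hmaj : HasSum (fun x : Site D => (E * WY) * ((∑ a, u x a * v' x a) * Real.exp (σ * l1 (x - pX)))) ((E * WY) * WX) := by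
    rw [hWX]; exact hX.hasSum.mul_left (E * WY)
  have h := tsum_of_norm_bounded hmaj fun x => by
    rw [Real.norm_eq_abs]
    refine (Finset.abs_sum_le_sum_abs (fun a => ∑' y : Site D, ∑ f, P x y a f * Q y x f a) Finset.univ).trans ?_
    rw [Finset.sum_mul, Finset.mul_sum]
    exact Finset.sum_le_sum fun a _ => (inner x a).trans (le_of_eq (by ring))
  rw [Real.norm_eq_abs] at h
  calc |tr (comp P Q)| = |∑' x : Site D, ∑ a, ∑' y : Site D, ∑ f, P x y a f * Q y x f a| := rfl
    _ ≤ E * WY * WX := h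
    _ = E * WX * WY := by ring

/-! ## §2 The four-term algebra -/

/-- [folklore] **THE FOUR TERMS OF THE SPLIT BUBBLE, EACH GROUPED ON THE GAINING SIDE** (spread legs, localised pieces): column-charge-free pieces stay to the RIGHT of
their leg, row-charge-free pieces are rotated ∕ re-associated to the LEFT of the next leg, and the mixed terms keep the leg sandwiched. -/
theorem biBubble_chargeSplit_eq {A B Vc Vr Wc Wr : MKer D F} (hA : Spr A) (hB : Spr B) (hVc : Loc Vc) (hVr : Loc Vr) (hWc : Loc Wc) (hWr : Loc Wr) :
    biBubble A (Vc + Vr) B (Wc + Wr)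
      = tr (comp (comp A Vc) (comp B Wc)) + tr (comp (comp (comp Wr A) Vc) B)
        + tr (comp A (comp (comp Vr B) Wc)) + tr (comp (comp Vr B) (comp Wr A)) := by
  have tA := hA.tame; have tB := hB.tame
  have tVc := hVc.tame; have tVr := hVr.tame; have tWc := hWc.tame; have tWr := hWr.tame
  have lAVc : Loc (comp A Vc) := hA.comp_loc hVc
  have lAVr : Loc (comp A Vr) := hA.comp_loc hVr
  have lBWc : Loc (comp B Wc) := hB.comp_loc hWc
  have lBWr : Loc (comp B Wr) := hB.comp_loc hWr
  have lVrB : Loc (comp Vr B) := hVr.comp_spr hB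
  have lWrA : Loc (comp Wr A) := hWr.comp_spr hA
  -- expand
  have e1 : comp A (Vc + Vr) = comp A Vc + comp A Vr := comp_add_right_tame tA tVc tVr
  have e2 : comp B (Wc + Wr) = comp B Wc + comp B Wr := comp_add_right_tame tB tWc tWr
  have e3 : comp (comp A Vc + comp A Vr) (comp B Wc + comp B Wr)
      = comp (comp A Vc) (comp B Wc) + comp (comp A Vc) (comp B Wr) + (comp (comp A Vr) (comp B Wc) + comp (comp A Vr) (comp B Wr)) := by
    rw [comp_add_left_tame lAVc.tame lAVr.tame (lBWc.add lBWr).tame, comp_add_right_tame lAVc.tame lBWc.tame lBWr.tame,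
      comp_add_right_tame lAVr.tame lBWc.tame lBWr.tame]
  have l11 : Loc (comp (comp A Vc) (comp B Wc)) := lAVc.comp lBWc
  have l12 : Loc (comp (comp A Vc) (comp B Wr)) := lAVc.comp lBWr
  have l21 : Loc (comp (comp A Vr) (comp B Wc)) := lAVr.comp lBWc
  have l22 : Loc (comp (comp A Vr) (comp B Wr)) := lAVr.comp lBWr
  unfold PackedKernelSplit.biBubble
  rw [e1, e2, e3, tr_add_loc (l11.add l12) (l21.add l22), tr_add_loc l11 l12, tr_add_loc l21 l22]
  -- term (c,r): `tr((A∘Vc)∘(B∘Wr)) = tr(((Wr∘A)∘Vc)∘B)`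
  have h12 : tr (comp (comp A Vc) (comp B Wr)) = tr (comp (comp (comp Wr A) Vc) B) := by
    rw [comp_assoc_tame lAVc.tame tB tWr, ← tr_comp_comm_loc hWr (lAVc.comp_spr hB).tame, comp_assoc_tame tWr lAVc.tame tB,
      comp_assoc_tame tWr tA tVc]
  -- term (r,c): `tr((A∘Vr)∘(B∘Wc)) = tr(A∘((Vr∘B)∘Wc))`
  have h21 : tr (comp (comp A Vr) (comp B Wc)) = tr (comp A (comp (comp Vr B) Wc)) := by
    rw [← comp_assoc_tame tA tVr lBWc.tame, comp_assoc_tame tVr tB tWc]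
  -- term (r,r): `tr((A∘Vr)∘(B∘Wr)) = tr((Vr∘B)∘(Wr∘A))`
  have h22 : tr (comp (comp A Vr) (comp B Wr)) = tr (comp (comp Vr B) (comp Wr A)) := by
    rw [← comp_assoc_tame tA tVr lBWr.tame, tr_comp_comm_loc (hVr.comp lBWr) tA |>.symm, ← comp_assoc_tame tVr lBWr.tame tA,
      ← comp_assoc_tame tB tWr tA, ← comp_assoc_tame tVr tB lWrA.tame]
  rw [h12, h21, h22]
  ring

/-! ## §3 The bound -/

/-- [folklore] **THE TWO-GAIN BUBBLE BOUND IN WEIGHTED-MASS CURRENCY.**  Legs `A`, `B` decaying at rate `θ > 0` with sups `βA, βB`, unit-difference envelopes `β′A, β′B` in both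
variables and mixed unit second-difference envelopes `β″A, β″B` (all with the decay `e^{−θ|·|₁}`); vertex pieces `Vc, Wc` localised, column-banded (`R`) and
column-charge-free, `Vr, Wr` localised, row-banded and row-charge-free; σ-weighted (`σ ≥ 0`) column masses of `Vc` about `p` and of `Wc` about `p′` at most `MVc, MWc`,
row masses of `Vr` about `p` and of `Wr` about `p′` at most `MVr, MWr`.  Then
`|biBubble A (Vc + Vr) B (Wc + Wr)| ≤ e^{−min(σ,2θ)|p − p′|₁}·((β′A·R·e^{θR})·(β′B·R·e^{θR})·(MVc·MWc + MVr·MWr) + (β″A·R²·e^{2θR})·βB·MVc·MWr + βA·(β″B·R²·e^{2θR})·MVr·MWc)`. -/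
theorem abs_biBubble_le_of_chargeSplit {A B Vc Vr Wc Wr : MKer D F} {θ σ R βA βB β'A β'B β''A β''B MVc MVr MWc MWr : ℝ} {p p' : Site D}
    (hθ : 0 < θ) (hσ : 0 ≤ σ) (hR : 0 ≤ R) (hβA : 0 ≤ βA) (hβB : 0 ≤ βB) (hβ'A : 0 ≤ β'A) (hβ'B : 0 ≤ β'B) (hβ''A : 0 ≤ β''A) (hβ''B : 0 ≤ β''B)
    -- the legs
    (hAd : Decays A βA θ) (hBd : Decays B βB θ)
    (hA₁ : ∀ (ρ : Fin D) (w y : Site D) (a b : F), |A (w + unitVec ρ) y a b - A w y a b| ≤ β'A * Real.exp (-θ * l1 (w - y)))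
    (hA₂ : ∀ (ρ : Fin D) (x w : Site D) (a b : F), |A x (w + unitVec ρ) a b - A x w a b| ≤ β'A * Real.exp (-θ * l1 (x - w)))
    (hA₁₂ : ∀ (ρ ρ' : Fin D) (w y : Site D) (a b : F),
      |A (w + unitVec ρ) (y + unitVec ρ') a b - A w (y + unitVec ρ') a b - A (w + unitVec ρ) y a b + A w y a b| ≤ β''A * Real.exp (-θ * l1 (w - y)))
    (hB₁ : ∀ (ρ : Fin D) (w y : Site D) (a b : F), |B (w + unitVec ρ) y a b - B w y a b| ≤ β'B * Real.exp (-θ * l1 (w - y)))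
    (hB₂ : ∀ (ρ : Fin D) (x w : Site D) (a b : F), |B x (w + unitVec ρ) a b - B x w a b| ≤ β'B * Real.exp (-θ * l1 (x - w)))
    (hB₁₂ : ∀ (ρ ρ' : Fin D) (w y : Site D) (a b : F),
      |B (w + unitVec ρ) (y + unitVec ρ') a b - B w (y + unitVec ρ') a b - B (w + unitVec ρ) y a b + B w y a b| ≤ β''B * Real.exp (-θ * l1 (w - y)))
    -- the pieces: localised, banded, charge-free
    (hVc : Loc Vc) (hVr : Loc Vr) (hWc : Loc Wc) (hWr : Loc Wr)
    (hVcR : ∀ (y z : Site D) (f b : F), R < l1 (y - z) → Vc y z f b = 0) (hVc0 : ∀ (z : Site D) (f b : F), ∑' y : Site D, Vc y z f b = 0)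
    (hWcR : ∀ (y z : Site D) (f b : F), R < l1 (y - z) → Wc y z f b = 0) (hWc0 : ∀ (z : Site D) (f b : F), ∑' y : Site D, Wc y z f b = 0)
    (hVrR : ∀ (y z : Site D) (f b : F), R < l1 (z - y) → Vr y z f b = 0) (hVr0 : ∀ (y : Site D) (f b : F), ∑' z : Site D, Vr y z f b = 0)
    (hWrR : ∀ (y z : Site D) (f b : F), R < l1 (z - y) → Wr y z f b = 0) (hWr0 : ∀ (y : Site D) (f b : F), ∑' z : Site D, Wr y z f b = 0)
    -- the σ-weighted masses
    (hVcS : Summable fun z : Site D => (∑ b, ∑' y : Site D, ∑ f, |Vc y z f b|) * Real.exp (σ * l1 (z - p)))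
    (hVcM : ∑' z : Site D, (∑ b, ∑' y : Site D, ∑ f, |Vc y z f b|) * Real.exp (σ * l1 (z - p)) ≤ MVc)
    (hWcS : Summable fun x : Site D => (∑ a, ∑' w : Site D, ∑ g, |Wc w x g a|) * Real.exp (σ * l1 (x - p')))
    (hWcM : ∑' x : Site D, (∑ a, ∑' w : Site D, ∑ g, |Wc w x g a|) * Real.exp (σ * l1 (x - p')) ≤ MWc)
    (hVrS : Summable fun y : Site D => (∑ f, ∑' z : Site D, ∑ b, |Vr y z f b|) * Real.exp (σ * l1 (y - p)))
    (hVrM : ∑' y : Site D, (∑ f, ∑' z : Site D, ∑ b, |Vr y z f b|) * Real.exp (σ * l1 (y - p)) ≤ MVr)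
    (hWrS : Summable fun w : Site D => (∑ g, ∑' x : Site D, ∑ h, |Wr w x g h|) * Real.exp (σ * l1 (w - p')))
    (hWrM : ∑' w : Site D, (∑ g, ∑' x : Site D, ∑ h, |Wr w x g h|) * Real.exp (σ * l1 (w - p')) ≤ MWr) :
    |biBubble A (Vc + Vr) B (Wc + Wr)|
      ≤ Real.exp (-(min σ (2 * θ)) * l1 (p - p'))
          * ((β'A * R * Real.exp (θ * R)) * (β'B * R * Real.exp (θ * R)) * (MVc * MWc + MVr * MWr)
            + (β''A * R ^ 2 * Real.exp (2 * θ * R)) * βB * (MVc * MWr) + βA * (β''B * R ^ 2 * Real.exp (2 * θ * R)) * (MVr * MWc)) := by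
  classical
  have hA : Spr A := ⟨βA, θ, hθ, hAd⟩
  have hB : Spr B := ⟨βB, θ, hθ, hBd⟩
  have hθ0 : 0 ≤ θ := hθ.le
  -- the constants
  obtain ⟨cA', hcA'⟩ : ∃ cA' : ℝ, cA' = β'A * R * Real.exp (θ * R) := ⟨_, rfl⟩
  obtain ⟨cB', hcB'⟩ : ∃ cB' : ℝ, cB' = β'B * R * Real.exp (θ * R) := ⟨_, rfl⟩
  obtain ⟨cA'', hcA''⟩ : ∃ cA'' : ℝ, cA'' = β''A * R ^ 2 * Real.exp (2 * θ * R) := ⟨_, rfl⟩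
  obtain ⟨cB'', hcB''⟩ : ∃ cB'' : ℝ, cB'' = β''B * R ^ 2 * Real.exp (2 * θ * R) := ⟨_, rfl⟩
  have hcA'0 : 0 ≤ cA' := by rw [hcA']; positivity
  have hcB'0 : 0 ≤ cB' := by rw [hcB']; positivity
  have hcA''0 : 0 ≤ cA'' := by rw [hcA'']; positivity
  have hcB''0 : 0 ≤ cB'' := by rw [hcB'']; positivity
  -- the masses (as functions) and their weighted totals
  have hmVc0 : ∀ (z : Site D) (b : F), 0 ≤ ∑' y : Site D, ∑ f, |Vc y z f b| := fun z b => tsum_nonneg fun y => Finset.sum_nonneg fun f _ => abs_nonneg _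
  have hmWc0 : ∀ (x : Site D) (a : F), 0 ≤ ∑' w : Site D, ∑ g, |Wc w x g a| := fun x a => tsum_nonneg fun w => Finset.sum_nonneg fun g _ => abs_nonneg _
  have hmVr0 : ∀ (y : Site D) (f : F), 0 ≤ ∑' z : Site D, ∑ b, |Vr y z f b| := fun y f => tsum_nonneg fun z => Finset.sum_nonneg fun b _ => abs_nonneg _
  have hmWr0 : ∀ (w : Site D) (g : F), 0 ≤ ∑' x : Site D, ∑ h, |Wr w x g h| := fun w g => tsum_nonneg fun x => Finset.sum_nonneg fun h _ => abs_nonneg _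
  obtain ⟨WVc, hWVc⟩ : ∃ WVc : ℝ, WVc = ∑' z : Site D, (∑ b, ∑' y : Site D, ∑ f, |Vc y z f b|) * Real.exp (σ * l1 (z - p)) := ⟨_, rfl⟩
  obtain ⟨WWc, hWWc⟩ : ∃ WWc : ℝ, WWc = ∑' x : Site D, (∑ a, ∑' w : Site D, ∑ g, |Wc w x g a|) * Real.exp (σ * l1 (x - p')) := ⟨_, rfl⟩
  obtain ⟨WVr, hWVr⟩ : ∃ WVr : ℝ, WVr = ∑' y : Site D, (∑ f, ∑' z : Site D, ∑ b, |Vr y z f b|) * Real.exp (σ * l1 (y - p)) := ⟨_, rfl⟩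
  obtain ⟨WWr, hWWr⟩ : ∃ WWr : ℝ, WWr = ∑' w : Site D, (∑ g, ∑' x : Site D, ∑ h, |Wr w x g h|) * Real.exp (σ * l1 (w - p')) := ⟨_, rfl⟩
  have hWVc0 : 0 ≤ WVc := by rw [hWVc]; exact tsum_nonneg fun z => mul_nonneg (Finset.sum_nonneg fun b _ => hmVc0 z b) (Real.exp_pos _).le
  have hWWc0 : 0 ≤ WWc := by rw [hWWc]; exact tsum_nonneg fun x => mul_nonneg (Finset.sum_nonneg fun a _ => hmWc0 x a) (Real.exp_pos _).le
  have hWVr0 : 0 ≤ WVr := by rw [hWVr]; exact tsum_nonneg fun y => mul_nonneg (Finset.sum_nonneg fun f _ => hmVr0 y f) (Real.exp_pos _).le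
  have hWWr0 : 0 ≤ WWr := by rw [hWWr]; exact tsum_nonneg fun w => mul_nonneg (Finset.sum_nonneg fun g _ => hmWr0 w g) (Real.exp_pos _).le
  have hVcM' : WVc ≤ MVc := by rw [hWVc]; exact hVcM
  have hWcM' : WWc ≤ MWc := by rw [hWWc]; exact hWcM
  have hVrM' : WVr ≤ MVr := by rw [hWVr]; exact hVrM
  have hWrM' : WWr ≤ MWr := by rw [hWWr]; exact hWrM
  have hMVc0 : 0 ≤ MVc := hWVc0.trans hVcM'
  have hMWc0 : 0 ≤ MWc := hWWc0.trans hWcM'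
  have hMVr0 : 0 ≤ MVr := hWVr0.trans hVrM'
  have hMWr0 : 0 ≤ MWr := hWWr0.trans hWrM'
  obtain ⟨E, hE⟩ : ∃ E : ℝ, E = Real.exp (-(min σ (2 * θ)) * l1 (p - p')) := ⟨_, rfl⟩
  have hE0 : 0 ≤ E := by rw [hE]; exact (Real.exp_pos _).le
  have hE' : Real.exp (-(min σ (2 * θ)) * l1 (p' - p)) = E := by rw [hE, l1_sub_symm p' p]
  -- scaling of a weighted mass: summability and value
  have scale : ∀ {m φ : Site D → F → ℝ} {q : Site D} (c : ℝ), (∀ x a, φ x a = c * m x a) →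
      Summable (fun x : Site D => (∑ a, m x a) * Real.exp (σ * l1 (x - q))) →
      Summable (fun x : Site D => (∑ a, φ x a) * Real.exp (σ * l1 (x - q))) ∧
        (∑' x : Site D, (∑ a, φ x a) * Real.exp (σ * l1 (x - q))) = c * ∑' x : Site D, (∑ a, m x a) * Real.exp (σ * l1 (x - q)) := by
    intro m φ q c hφ h
    have e : (fun x : Site D => (∑ a, φ x a) * Real.exp (σ * l1 (x - q))) = fun x => c * ((∑ a, m x a) * Real.exp (σ * l1 (x - q))) := by
      funext x
      rw [Finset.sum_congr rfl fun a _ => hφ x a, ← Finset.mul_sum]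
      ring
    rw [e]
    exact ⟨h.mul_left c, tsum_mul_left⟩
  -- the six envelopes in the template form `e^{−θ|·|₁}·u·v`
  have hP11 : ∀ (x z : Site D) (a b : F), |comp A Vc x z a b| ≤ Real.exp (-θ * l1 (x - z)) * cA' * ∑' y : Site D, ∑ f, |Vc y z f b| := fun x z a b =>
    (abs_comp_le_of_colFree_unitDiff hA.tame hVc hβ'A hθ0 hA₂ (fun y f h => hVcR y z f b h) (fun f => hVc0 z f b) x a).trans (le_of_eq (by rw [hcA']; ring))
  have hQ11 : ∀ (z x : Site D) (b a : F), |comp B Wc z x b a| ≤ Real.exp (-θ * l1 (z - x)) * cB' * ∑' w : Site D, ∑ g, |Wc w x g a| := fun z x b a =>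
    (abs_comp_le_of_colFree_unitDiff hB.tame hWc hβ'B hθ0 hB₂ (fun y f h => hWcR y x f a h) (fun f => hWc0 x f a) z b).trans (le_of_eq (by rw [hcB']; ring))
  have hP12 : ∀ (w z : Site D) (g b : F), |comp (comp Wr A) Vc w z g b|
      ≤ Real.exp (-θ * l1 (w - z)) * (∑' x : Site D, ∑ h, |Wr w x g h|) * (cA'' * ∑' y : Site D, ∑ f, |Vc y z f b|) := fun w z g b =>
    (abs_comp_comp_le_of_unitDiffMixed hWr hA hVc hβ''A hθ0 hA₁₂ (fun x h hh => hWrR w x g h hh) (fun h => hWr0 w g h)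
      (fun y f h => hVcR y z f b h) (fun f => hVc0 z f b)).trans (le_of_eq (by rw [hcA'']; ring))
  have hQ12 : ∀ (z w : Site D) (b g : F), |B z w b g| ≤ Real.exp (-θ * l1 (z - w)) * βB * 1 := fun z w b g =>
    (hBd z w b g).trans (le_of_eq (by ring))
  have hP21 : ∀ (x y : Site D) (a f : F), |A x y a f| ≤ Real.exp (-θ * l1 (x - y)) * βA * 1 := fun x y a f =>
    (hAd x y a f).trans (le_of_eq (by ring))
  have hQ21 : ∀ (y x : Site D) (f a : F), |comp (comp Vr B) Wc y x f a|
      ≤ Real.exp (-θ * l1 (y - x)) * ((∑' z : Site D, ∑ b, |Vr y z f b|) * cB'') * ∑' w : Site D, ∑ g, |Wc w x g a| := fun y x f a =>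
    (abs_comp_comp_le_of_unitDiffMixed hVr hB hWc hβ''B hθ0 hB₁₂ (fun z b hh => hVrR y z f b hh) (fun b => hVr0 y f b)
      (fun w g h => hWcR w x g a h) (fun g => hWc0 x g a)).trans (le_of_eq (by rw [hcB'']; ring))
  have hP22 : ∀ (y w : Site D) (f g : F), |comp Vr B y w f g| ≤ Real.exp (-θ * l1 (y - w)) * (∑' z : Site D, ∑ b, |Vr y z f b|) * cB' := fun y w f g =>
    (abs_comp_le_of_rowFree_unitDiff hVr hB.tame hβ'B hθ0 hB₁ (fun z b h => hVrR y z f b h) (fun b => hVr0 y f b) w g).trans (le_of_eq (by rw [hcB']; ring))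
  have hQ22 : ∀ (w y : Site D) (g f : F), |comp Wr A w y g f| ≤ Real.exp (-θ * l1 (w - y)) * (∑' x : Site D, ∑ h, |Wr w x g h|) * cA' := fun w y g f =>
    (abs_comp_le_of_rowFree_unitDiff hWr hA.tame hβ'A hθ0 hA₁ (fun x h hh => hWrR w x g h hh) (fun h => hWr0 w g h) y f).trans (le_of_eq (by rw [hcA']; ring))
  -- term (c,c)
  have t11 : |tr (comp (comp A Vc) (comp B Wc))| ≤ E * (cA' * WWc) * (cB' * WVc) := by
    obtain ⟨sXh, sXe⟩ := scale (m := fun x a => ∑' w : Site D, ∑ g, |Wc w x g a|) (φ := fun x a => cA' * ∑' w : Site D, ∑ g, |Wc w x g a|) (q := p')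
      cA' (fun _ _ => rfl) hWcS
    obtain ⟨sYh, sYe⟩ := scale (m := fun z b => ∑' y : Site D, ∑ f, |Vc y z f b|) (φ := fun z b => (∑' y : Site D, ∑ f, |Vc y z f b|) * cB') (q := p)
      cB' (fun _ _ => by ring) hVcS
    have h := abs_tr_comp_le_weighted (P := comp A Vc) (Q := comp B Wc) (u := fun _ _ => cA') (v := fun z b => ∑' y : Site D, ∑ f, |Vc y z f b|)
      (u' := fun _ _ => cB') (v' := fun x a => ∑' w : Site D, ∑ g, |Wc w x g a|) hθ0 hσ (fun _ _ => hcA'0) hmVc0 (fun _ _ => hcB'0) hmWc0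
      hP11 hQ11 p' p sXh sYh
    beta_reduce at h sXe sYe
    rw [hE', sXe, sYe, ← hWWc, ← hWVc] at h
    exact h
  -- term (c,r)
  have t12 : |tr (comp (comp (comp Wr A) Vc) B)| ≤ E * WWr * (cA'' * βB * WVc) := by
    obtain ⟨sXh, sXe⟩ := scale (m := fun w g => ∑' x : Site D, ∑ h, |Wr w x g h|) (φ := fun w g => (∑' x : Site D, ∑ h, |Wr w x g h|) * 1) (q := p')
      1 (fun _ _ => by ring) hWrS
    obtain ⟨sYh, sYe⟩ := scale (m := fun z b => ∑' y : Site D, ∑ f, |Vc y z f b|) (φ := fun z b => (cA'' * ∑' y : Site D, ∑ f, |Vc y z f b|) * βB) (q := p)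
      (cA'' * βB) (fun _ _ => by ring) hVcS
    have h := abs_tr_comp_le_weighted (P := comp (comp Wr A) Vc) (Q := B) (u := fun w g => ∑' x : Site D, ∑ h, |Wr w x g h|)
      (v := fun z b => cA'' * ∑' y : Site D, ∑ f, |Vc y z f b|) (u' := fun _ _ => βB) (v' := fun _ _ => (1 : ℝ)) hθ0 hσ hmWr0
      (fun z b => mul_nonneg hcA''0 (hmVc0 z b)) (fun _ _ => hβB) (fun _ _ => zero_le_one) hP12 hQ12 p' p sXh sYh
    beta_reduce at h sXe sYe
    rw [hE', sXe, sYe, one_mul, ← hWWr, ← hWVc] at h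
    exact h
  -- term (r,c)
  have t21 : |tr (comp A (comp (comp Vr B) Wc))| ≤ E * (βA * WWc) * (cB'' * WVr) := by
    obtain ⟨sXh, sXe⟩ := scale (m := fun x a => ∑' w : Site D, ∑ g, |Wc w x g a|) (φ := fun x a => βA * ∑' w : Site D, ∑ g, |Wc w x g a|) (q := p')
      βA (fun _ _ => rfl) hWcS
    obtain ⟨sYh, sYe⟩ := scale (m := fun y f => ∑' z : Site D, ∑ b, |Vr y z f b|) (φ := fun y f => 1 * ((∑' z : Site D, ∑ b, |Vr y z f b|) * cB'')) (q := p)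
      cB'' (fun _ _ => by ring) hVrS
    have h := abs_tr_comp_le_weighted (P := A) (Q := comp (comp Vr B) Wc) (u := fun _ _ => βA) (v := fun _ _ => (1 : ℝ))
      (u' := fun y f => (∑' z : Site D, ∑ b, |Vr y z f b|) * cB'') (v' := fun x a => ∑' w : Site D, ∑ g, |Wc w x g a|) hθ0 hσ (fun _ _ => hβA)
      (fun _ _ => zero_le_one) (fun y f => mul_nonneg (hmVr0 y f) hcB''0) hmWc0 hP21 hQ21 p' p sXh sYh
    beta_reduce at h sXe sYe
    rw [hE', sXe, sYe, ← hWWc, ← hWVr] at h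
    exact h
  -- term (r,r)
  have t22 : |tr (comp (comp Vr B) (comp Wr A))| ≤ E * (cA' * WVr) * (cB' * WWr) := by
    obtain ⟨sXh, sXe⟩ := scale (m := fun y f => ∑' z : Site D, ∑ b, |Vr y z f b|) (φ := fun y f => (∑' z : Site D, ∑ b, |Vr y z f b|) * cA') (q := p)
      cA' (fun _ _ => by ring) hVrS
    obtain ⟨sYh, sYe⟩ := scale (m := fun w g => ∑' x : Site D, ∑ h, |Wr w x g h|) (φ := fun w g => cB' * ∑' x : Site D, ∑ h, |Wr w x g h|) (q := p')
      cB' (fun _ _ => rfl) hWrS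
    have h := abs_tr_comp_le_weighted (P := comp Vr B) (Q := comp Wr A) (u := fun y f => ∑' z : Site D, ∑ b, |Vr y z f b|) (v := fun _ _ => cB')
      (u' := fun w g => ∑' x : Site D, ∑ h, |Wr w x g h|) (v' := fun _ _ => cA') hθ0 hσ hmVr0 (fun _ _ => hcB'0) hmWr0 (fun _ _ => hcA'0)
      hP22 hQ22 p p' sXh sYh
    beta_reduce at h sXe sYe
    rw [← hE, sXe, sYe, ← hWVr, ← hWWr] at h
    exact h
  -- assemble
  rw [biBubble_chargeSplit_eq hA hB hVc hVr hWc hWr]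
  have hsum : |tr (comp (comp A Vc) (comp B Wc)) + tr (comp (comp (comp Wr A) Vc) B) + tr (comp A (comp (comp Vr B) Wc)) + tr (comp (comp Vr B) (comp Wr A))|
      ≤ E * (cA' * WWc) * (cB' * WVc) + E * WWr * (cA'' * βB * WVc) + E * (βA * WWc) * (cB'' * WVr) + E * (cA' * WVr) * (cB' * WWr) := by
    refine (abs_add_le _ _).trans (add_le_add ((abs_add_le _ _).trans (add_le_add ((abs_add_le _ _).trans (add_le_add t11 t12)) t21)) t22)
  refine hsum.trans ?_
  rw [← hE, ← hcA', ← hcB', ← hcA'', ← hcB'']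
  have e : E * (cA' * WWc) * (cB' * WVc) + E * WWr * (cA'' * βB * WVc) + E * (βA * WWc) * (cB'' * WVr) + E * (cA' * WVr) * (cB' * WWr)
      = E * (cA' * cB' * (WVc * WWc + WVr * WWr) + cA'' * βB * (WVc * WWr) + βA * cB'' * (WVr * WWc)) := by ring
  rw [e]
  refine mul_le_mul_of_nonneg_left ?_ hE0
  have m1 : WVc * WWc ≤ MVc * MWc := mul_le_mul hVcM' hWcM' hWWc0 hMVc0
  have m2 : WVr * WWr ≤ MVr * MWr := mul_le_mul hVrM' hWrM' hWWr0 hMVr0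
  have m3 : WVc * WWr ≤ MVc * MWr := mul_le_mul hVcM' hWrM' hWWr0 hMVc0
  have m4 : WVr * WWc ≤ MVr * MWc := mul_le_mul hVrM' hWcM' hWWc0 hMVr0
  have c1 : 0 ≤ cA' * cB' := mul_nonneg hcA'0 hcB'0
  have c2 : 0 ≤ cA'' * βB := mul_nonneg hcA''0 hβB
  have c3 : 0 ≤ βA * cB'' := mul_nonneg hβA hcB''0
  exact add_le_add (add_le_add (mul_le_mul_of_nonneg_left (add_le_add m1 m2) c1) (mul_le_mul_of_nonneg_left m3 c2))
    (mul_le_mul_of_nonneg_left m4 c3)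

end Summit.QuantumFields.BalabanUV.Beta.D1BFx.ChargeFreeBubble

end
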